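import Literature.Analysis.FluidPDE.CylindricalCutoff
import Literature.Analysis.FluidPDE.LeiZhang2011Setting
import HarnessLib

/-!
# Lei–Ren–Zhang 2019, §§2–3: from the essential supremum over one period cell to every point

Analysis/FluidPDE proofs file (theorems only, no definitions, no named facts), on the discharge
path of the named fact `Literature.Analysis.FluidPDE.leiRenZhang2019_liouville_periodic`
(Z. Lei, X. Ren, Q. S. Zhang, arXiv:1902.11229 = Math. Ann. 383 (2022), Theorem 1.1). The mean
value inequality per period (`meanValue_inequality_periodic`, Lemma 2.1: "`sup_{P_{σ₁R}} Λ^ℓ ≤ …`")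
is stated in the tree as a bound on the `L^∞` norm over the space–time period cell
`(−r², 0] × {0 ≤ x₂ ≤ P, r' ≤ r}`; the oscillation argument of §3 (Corollary 3.2: "`sup_{P_{R/4}} Λ`")
uses the bound at EVERY point of `[−r², 0] × {r' ≤ r}` (all `x₂`, by periodicity). This file
proves that passage for a continuous, axially `P`-periodic space–time function: a.e. on the cell
⇒ everywhere on the open cell (continuity, `le_of_ae_le_of_continuousOn`) ⇒ on its closure, which
contains the closed cell ⇒ everywhere by periodicity in `x₂`.

* `forall_le_of_eLpNorm_top_periodCell_le`.

## References

* Z. Lei, X. Ren, Q. S. Zhang, arXiv:1902.11229, Lemma 2.1 and Corollary 3.2 (arXiv pp. 5, 8).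
  [LeiRenZhang2019]
-/

noncomputable section

open MeasureTheory Set Function Filter Metric
open _root_.Topology
open scoped ENNReal

namespace Literature.Analysis.FluidPDE

namespace LeiRenZhang2019

open LeiZhang2011

/-- `cylRadius (x + t e_z) = cylRadius x`. [folklore] -/
private theorem cylRadius_add_smul_eZ_psb (x : EuclideanSpace ℝ (Fin 3)) (t : ℝ) :
    cylRadius (x + t • eZ) = cylRadius x := by
  rw [← cylRadius_horizPart (x + t • eZ), horizPart_add_smul_eZ, cylRadius_horizPart]

/-- The closed period cell lies in the closure of the open one: every `x` with `0 ≤ x₂ ≤ P`,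
`r'(x) ≤ r` (`P, r > 0`) is a limit of points with `0 < x₂ < P`, `r' < r`. [folklore] -/
private theorem mem_closure_openCell_psb {P r : ℝ} (hP : 0 < P) (hr : 0 < r)
    {x : EuclideanSpace ℝ (Fin 3)} (hx : x 2 ∈ Icc 0 P ∧ cylRadius x ≤ r) :
    x ∈ closure {y : EuclideanSpace ℝ (Fin 3) | y 2 ∈ Ioo 0 P ∧ cylRadius y < r} := by
  -- the path `γ(s) = (1 − s) x_h + ((1 − s) x₂ + s P/2) e_z`, `γ(0) = x`, inside for `0 < s < 1`
  set γ : ℝ → EuclideanSpace ℝ (Fin 3) := fun s =>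
    (1 - s) • horizPart x + ((1 - s) * x 2 + s * (P / 2)) • eZ with hγ
  have hγc : Continuous γ := by
    simp only [hγ]
    fun_prop
  have hγ0 : γ 0 = x := by
    simp only [hγ, sub_zero, one_smul, one_mul, zero_mul, add_zero]
    rw [horizPart_apply, sub_add_cancel]
  have htend : Tendsto γ (𝓝[>] 0) (𝓝 x) := by
    rw [← hγ0]
    exact (hγc.tendsto 0).mono_left nhdsWithin_le_nhds
  refine mem_closure_of_tendsto htend ?_
  have hev : ∀ᶠ s in 𝓝[>] (0 : ℝ), s < 1 := by
    have : Ioo (0 : ℝ) 1 ∈ 𝓝[>] (0 : ℝ) := Ioo_mem_nhdsGT one_pos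
    filter_upwards [this] with s hs
    exact hs.2
  filter_upwards [hev, self_mem_nhdsWithin] with s hs1 hs0
  have hs0' : 0 < s := hs0
  have h2 : γ s 2 = (1 - s) * x 2 + s * (P / 2) := by
    simp only [hγ, PiLp.add_apply, PiLp.smul_apply, smul_eq_mul, horizPart_apply_two, mul_zero, zero_add]
    simp [eZ]
  have hrad : cylRadius (γ s) = (1 - s) * cylRadius x := by
    simp only [hγ]
    rw [cylRadius_add_smul_eZ_psb, cylRadius_smul, cylRadius_horizPart, abs_of_pos (by linarith)]
  refine ⟨?_, ?_⟩
  · rw [h2]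
    constructor
    · nlinarith [hx.1.1, hx.1.2]
    · nlinarith [hx.1.1, hx.1.2]
  · rw [hrad]
    have := hx.2
    nlinarith [cylRadius_nonneg x]

/-- **From the `L^∞` norm over one period cell to every point** (the passage from Lemma 2.1's
`sup_{P_{σ₁R}}` per period to the pointwise bounds used in Corollary 3.2). For a continuous,
nonnegative space–time function `g`, axially `P`-periodic in `x` (`P > 0`), and `r > 0`: if
`‖g‖_{L^∞((−r²,0] × {0 ≤ x₂ ≤ P, r' ≤ r})} ≤ X` (`X ≥ 0`), then `g ≤ X` at every point of
`[−r², 0] × {r' ≤ r}`. [cite: LeiRenZhang2019, Lemma 2.1 and Cor. 3.2 (arXiv pp. 5, 8; sup over P_{σR}, all z by periodicity)] -/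
theorem forall_le_of_eLpNorm_top_periodCell_le {g : ℝ × EuclideanSpace ℝ (Fin 3) → ℝ}
    (hgc : Continuous g) (hg0 : ∀ z, 0 ≤ g z) {P r X : ℝ} (hP : 0 < P) (hr : 0 < r) (hX : 0 ≤ X)
    (hper : ∀ t : ℝ, Function.Periodic (fun x => g (t, x)) (P • eZ))
    (hsup : eLpNorm g ∞ ((((volume : Measure ℝ).prod (volume : Measure (EuclideanSpace ℝ (Fin 3)))).restrict
      (Ioc (-r ^ 2) 0 ×ˢ {x : EuclideanSpace ℝ (Fin 3) | x 2 ∈ Icc 0 P ∧ cylRadius x ≤ r}))) ≤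
      ENNReal.ofReal X) :
    ∀ z ∈ Icc (-r ^ 2) 0 ×ˢ {x : EuclideanSpace ℝ (Fin 3) | cylRadius x ≤ r}, g z ≤ X := by
  set A : Set (ℝ × EuclideanSpace ℝ (Fin 3)) :=
    Ioc (-r ^ 2) 0 ×ˢ {x : EuclideanSpace ℝ (Fin 3) | x 2 ∈ Icc 0 P ∧ cylRadius x ≤ r} with hA
  set O : Set (ℝ × EuclideanSpace ℝ (Fin 3)) :=
    Ioo (-r ^ 2) 0 ×ˢ {x : EuclideanSpace ℝ (Fin 3) | x 2 ∈ Ioo 0 P ∧ cylRadius x < r} with hO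
  have hx2c : Continuous fun x : EuclideanSpace ℝ (Fin 3) => x 2 := (EuclideanSpace.proj (𝕜 := ℝ) (2 : Fin 3)).continuous
  have hOopen : IsOpen O := by
    refine isOpen_Ioo.prod ?_
    exact (isOpen_Ioo.preimage hx2c).inter (isOpen_lt continuous_cylRadius continuous_const)
  have hOA : O ⊆ A := prod_mono Ioo_subset_Ioc_self fun x hx => ⟨Ioo_subset_Icc_self hx.1, hx.2.le⟩
  -- a.e. on the cell
  have hae : ∀ᵐ z ∂((((volume : Measure ℝ).prod (volume : Measure (EuclideanSpace ℝ (Fin 3)))).restrict A)),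
      g z ≤ X := by
    have h := ae_le_eLpNormEssSup
      (μ := (((volume : Measure ℝ).prod (volume : Measure (EuclideanSpace ℝ (Fin 3)))).restrict A)) (f := g)
    rw [← eLpNorm_exponent_top] at h
    filter_upwards [h] with z hz
    have h1 := hz.trans hsup
    rw [Real.enorm_eq_ofReal (hg0 z)] at h1
    exact (ENNReal.ofReal_le_ofReal_iff hX).1 h1
  -- everywhere on the open cell, then on its closure
  have hOle : ∀ z ∈ O, g z ≤ X :=
    le_of_ae_le_of_continuousOn (μ := ((volume : Measure ℝ).prod (volume : Measure (EuclideanSpace ℝ (Fin 3)))))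
      hOopen hgc.continuousOn (ae_restrict_of_ae_restrict_of_subset hOA hae)
  have hcl : ∀ z ∈ closure O, g z ≤ X := fun z hz => le_on_closure hOle hgc.continuousOn continuousOn_const hz
  have hcell : ∀ z ∈ Icc (-r ^ 2) 0 ×ˢ {x : EuclideanSpace ℝ (Fin 3) | x 2 ∈ Icc 0 P ∧ cylRadius x ≤ r},
      g z ≤ X := by
    intro z hz
    apply hcl
    rw [hO, closure_prod_eq, mem_prod]
    have hne : (-r ^ 2 : ℝ) ≠ 0 := (neg_lt_zero.2 (by positivity : (0 : ℝ) < r ^ 2)).ne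
    rw [closure_Ioo hne]
    exact ⟨hz.1, mem_closure_openCell_psb hP hr hz.2⟩
  -- every `x₂`, by periodicity
  intro z hz
  set k : ℤ := ⌊z.2 2 / P⌋ with hk
  set x' : EuclideanSpace ℝ (Fin 3) := z.2 - k • (P • eZ) with hx'
  have hper' : g (z.1, x') = g z := by
    have h := (hper z.1).sub_zsmul_eq k (x := z.2)
    simpa [hx'] using h
  have hx'eq : x' = z.2 + (-(k : ℝ) * P) • eZ := by
    rw [hx', ← Int.cast_smul_eq_zsmul ℝ k, smul_smul, sub_eq_add_neg, ← neg_smul, neg_mul]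
  have hx'2 : x' 2 = z.2 2 - k * P := by
    rw [hx'eq]
    simp [eZ]
    ring
  have hx'r : cylRadius x' = cylRadius z.2 := by rw [hx'eq, cylRadius_add_smul_eZ_psb]
  have hx'cell : x' 2 ∈ Icc 0 P := by
    rw [hx'2]
    have h1 : (k : ℝ) ≤ z.2 2 / P := Int.floor_le _
    have h2 : z.2 2 / P < k + 1 := Int.lt_floor_add_one _
    rw [le_div_iff₀ hP] at h1
    rw [div_lt_iff₀ hP] at h2
    constructor <;> nlinarith
  have h := hcell (z.1, x') ⟨hz.1, hx'cell, by rw [hx'r]; exact hz.2⟩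
  rwa [hper'] at h

end LeiRenZhang2019

end Literature.Analysis.FluidPDE

end
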